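import Summits.PneNP.PneNP.Theorems.SfmBlMachineSpots

/-!
# Line «sfm-bl», MACHINE LAYER M2c: what the extraction computes (stmt-PneNP-20523)

FRONTIER F-N1c; nothing here bears on P vs NP.

The mathematical facts about the OUTPUT of the machine's spot extraction `SfmBlMachine.extract`
(M2b, `SfmBlMachineSpots`) that the five clauses of `SfmBl.exists_spot_decomposition` need for the
COMPUTED decomposition (labels `0` = remainder, `s + 1` = spot `s`):

* (i) TERMINATION / SPARSENESS (`extractStep_extract`, `find?_dense_extract_eq_none`,
  `eCount_sq_le_of_mem_cands`): a round either fixes the state or removes a remainder leg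
  (`count_zero_relabel_add`), so after more than `3m` rounds the state is fixed and NO candidate pair is
  dense: `e² ≤ γsq·|W₁|·|W₂|` for every candidate.
* (ii) COMPLETENESS OF THE CANDIDATES (`exists_mem_cands`): every connected set of pieces with
  `2 ≤ #S ≤ t₀` is (the pair of sides of) a candidate — the closed covering walk of M2a padded to length
  exactly `2(t₀ − 1)` (`exists_walk_length_add_two_mul`, `exists_mem_walksU_exact`; sides bookkeeping
  `length_sidesOf_add`).  With (i): the remainder is `(√γsq, t₀)`-sparse on connected pairs of the piece
  graph (singleton pairs carry no legs).
* (iii) THE SPOTS (`SpotInv`, `spotInv_extract`): every spot `s < r` was extracted from a candidate pair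
  `W = (W₁, W₂)` (so `|W₁| + |W₂| ≤ t₀`), all legs labelled `s + 1` run from `W₁` to `W₂`, and
  `γsq·|W₁|·|W₂| < (#legs of spot s)²`.  With `V₁ s, V₂ s :=` the endpoint pieces of the legs of spot `s` this
  gives (sides), (small), (dense), (covered); the `Finset`/`ℝ` translation is M5's dictionary.
-/

set_option linter.dupNamespace false -- `Summit.PneNP.PneNP.…`: summit = sub-problem name (D-0017 single-conjunct layout)

namespace Summit.PneNP.PneNP.Theorems.SfmBlMachine

open Literature.Computability.Complexity

/-! ## M2c (i): termination — after more rounds than legs, no candidate is dense -/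

section Fixpoint

variable (γsq : ℕ) (plegs : List PLeg) (cs : List Cand)

/-- Relabelling trades remainder legs for spot legs: `#zeros after + e = #zeros before`. -/
theorem count_zero_relabel_add (W : Cand) (r : ℕ) :
    ∀ (labels : List ℕ) (pl : List PLeg), labels.length = pl.length →
      (relabel pl labels r W).count 0 + ((labels.zip pl).filter fun q => inPair W q).length = labels.count 0 := by
  intro labels
  induction labels with
  | nil => intro pl h; simp [relabel]
  | cons a as ih =>
    intro pl h
    cases pl with
    | nil => simp at h
    | cons b bs =>
      have h' : as.length = bs.length := by simpa using h
      have ih' := ih bs h'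
      unfold relabel at ih' ⊢
      rw [List.zipWith_cons_cons, List.zip_cons_cons, List.filter_cons, List.count_cons]
      by_cases hp : inPair W (a, b) = true
      · have ha : a = 0 := by
          simp only [inPair, Bool.and_eq_true, decide_eq_true_eq] at hp
          exact hp.1
        have hne : (r + 1 == 0) = false := by simp
        rw [if_pos hp, if_pos hp, hne, List.length_cons, List.count_cons, ha]
        simp only [beq_self_eq_true, if_true, Bool.false_eq_true, if_false]
        omega
      · rw [if_neg hp, if_neg hp, List.count_cons]
        omega

/-- A dense pair carries at least one remainder leg. -/
theorem eCount_pos_of_dense {labels : List ℕ} {W : Cand} (h : dense γsq plegs labels W = true) :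
    0 < eCount plegs labels W := by
  unfold dense at h
  rw [decide_eq_true_eq] at h
  rcases Nat.eq_zero_or_pos (eCount plegs labels W) with h0 | h0
  · rw [h0] at h; simp at h
  · exact h0

/-- One round keeps one label per leg. -/
theorem length_extractStep_fst (st : List ℕ × ℕ) (hlen : st.1.length = plegs.length) :
    (extractStep γsq plegs cs st).1.length = plegs.length := by
  unfold extractStep
  cases cs.find? (fun W => dense γsq plegs st.1 W) with
  | none => exact hlen
  | some W => exact length_relabel plegs st.1 st.2 W hlen

/-- One round either fixes the state or strictly decreases the number of remainder legs. -/
theorem extractStep_fix_or_lt (st : List ℕ × ℕ) (hlen : st.1.length = plegs.length) :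
    extractStep γsq plegs cs st = st ∨ (extractStep γsq plegs cs st).1.count 0 < st.1.count 0 := by
  unfold extractStep
  cases hf : cs.find? (fun W => dense γsq plegs st.1 W) with
  | none => exact Or.inl rfl
  | some W =>
    right
    have hd : dense γsq plegs st.1 W = true := List.find?_some hf
    have he := eCount_pos_of_dense γsq plegs hd
    have hc := count_zero_relabel_add W st.2 st.1 plegs hlen
    unfold eCount at he
    show (relabel plegs st.1 st.2 W).count 0 < st.1.count 0
    omega

/-- A fixed state stays fixed. -/
theorem foldl_extractStep_of_fix {st : List ℕ × ℕ} (h : extractStep γsq plegs cs st = st) :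
    ∀ u : List Unit, u.foldl (fun st _ => extractStep γsq plegs cs st) st = st := by
  intro u
  induction u with
  | nil => rfl
  | cons _ u ih => rw [List.foldl_cons, h, ih]

/-- With more rounds than remainder legs the fold ends in a FIXED state. -/
theorem extractStep_foldl_eq :
    ∀ (u : List Unit) (st : List ℕ × ℕ), st.1.length = plegs.length → st.1.count 0 < u.length →
      extractStep γsq plegs cs (u.foldl (fun st _ => extractStep γsq plegs cs st) st)
        = u.foldl (fun st _ => extractStep γsq plegs cs st) st := by
  intro u
  induction u with
  | nil => intro st _ h; simp at h
  | cons _ u ih =>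
    intro st hlen hlt
    rw [List.foldl_cons]
    rcases extractStep_fix_or_lt γsq plegs cs st hlen with hfix | hdec
    · rw [hfix, foldl_extractStep_of_fix γsq plegs cs hfix, hfix]
    · refine ih _ (length_extractStep_fst γsq plegs cs st hlen) ?_
      rw [List.length_cons] at hlt
      omega

/-- **TERMINATION**: after more than `3m` rounds the extraction state is fixed … -/
theorem extractStep_extract (u : List Unit) (hu : plegs.length < u.length) :
    extractStep γsq plegs cs (extract γsq plegs cs u) = extract γsq plegs cs u := by
  unfold extract
  refine extractStep_foldl_eq γsq plegs cs u (extractInit plegs) (by simp [extractInit]) ?_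
  refine lt_of_le_of_lt ?_ hu
  simp only [extractInit]
  exact (List.count_le_length).trans (by rw [List.length_map])

/-- … hence NO candidate pair is dense for the final remainder. -/
theorem find?_dense_extract_eq_none (u : List Unit) (hu : plegs.length < u.length) :
    cs.find? (fun W => dense γsq plegs (extract γsq plegs cs u).1 W) = none := by
  have h := extractStep_extract γsq plegs cs u hu
  unfold extractStep at h
  cases hf : cs.find? (fun W => dense γsq plegs (extract γsq plegs cs u).1 W) with
  | none => rfl
  | some W =>
    rw [hf] at h
    have := congrArg Prod.snd h
    simp at this

/-- **SPARSENESS, machine form**: every candidate pair fails the density test for the final remainder: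
`e² ≤ γsq · |W₁| · |W₂|`. -/
theorem eCount_sq_le_of_mem_cands (u : List Unit) (hu : plegs.length < u.length) {W : Cand} (hW : W ∈ cs) :
    eCount plegs (extract γsq plegs cs u).1 W * eCount plegs (extract γsq plegs cs u).1 W
      ≤ γsq * W.1.length * W.2.length := by
  have h := find?_dense_extract_eq_none γsq plegs cs u hu
  rw [List.find?_eq_none] at h
  have := h W hW
  unfold dense at this
  simpa using this

end Fixpoint

/-! ## M2c (ii): every small connected pair is a candidate -/

section Candidates

variable (plegs : List PLeg)

/-- Padding: a walk of positive length can be lengthened by `2` without changing its support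
(go back and forth along its first edge). -/
theorem exists_walk_length_add_two {V : Type} {G : SimpleGraph V} [DecidableEq V] :
    ∀ {v w : V} (q : G.Walk v w), 0 < q.length →
      ∃ q' : G.Walk v w, q'.length = q.length + 2 ∧ q'.support.toFinset = q.support.toFinset := by
  intro v w q hq
  cases q with
  | nil => simp at hq
  | cons h q' =>
    rename_i u
    refine ⟨SimpleGraph.Walk.cons h (SimpleGraph.Walk.cons h.symm (SimpleGraph.Walk.cons h q')), ?_, ?_⟩
    · simp only [SimpleGraph.Walk.length_cons]
    · ext x
      simp only [SimpleGraph.Walk.support_cons, List.toFinset_cons, Finset.mem_insert, List.mem_toFinset]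
      constructor
      · rintro (hx | hx | hx | hx)
        · exact Or.inl hx
        · exact Or.inr (hx ▸ q'.start_mem_support)
        · exact Or.inl hx
        · exact Or.inr hx
      · rintro (hx | hx)
        · exact Or.inl hx
        · exact Or.inr (Or.inr (Or.inr hx))

/-- Padding, iterated: any even surplus. -/
theorem exists_walk_length_add_two_mul {V : Type} {G : SimpleGraph V} [DecidableEq V] {v w : V}
    (q : G.Walk v w) (hq : 0 < q.length) (k : ℕ) :
    ∃ q' : G.Walk v w, q'.length = q.length + 2 * k ∧ q'.support.toFinset = q.support.toFinset := by
  induction k with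
  | zero => exact ⟨q, by simp, rfl⟩
  | succ k ih =>
    obtain ⟨q₁, h₁, hs₁⟩ := ih
    obtain ⟨q₂, h₂, hs₂⟩ := exists_walk_length_add_two q₁ (by omega)
    exact ⟨q₂, by rw [h₂, h₁]; ring, hs₂.trans hs₁⟩

/-- **Every connected set of pieces with `2 ≤ #S = s + 1 ≤ t + 1` elements is the support of an enumerated
walk of length EXACTLY `2t`** (so one walk length serves all sizes up to `t₀ = t + 1`). -/
theorem exists_mem_walksU_exact (S : Finset Lab) (hS : ∀ P ∈ S, P ∈ pieces plegs) {s t : ℕ} (hs : 1 ≤ s)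
    (hst : s ≤ t) (hcard : S.card = s + 1) (hconn : ((pieceGraph plegs).induce (S : Set Lab)).Connected) :
    ∃ w ∈ walksU plegs (2 * t), w.2.toFinset = S := by
  classical
  obtain ⟨v, hv⟩ : S.Nonempty := Finset.card_pos.1 (by rw [hcard]; exact Nat.succ_pos s)
  obtain ⟨p, hlen, hsupp⟩ :=
    Summit.QuantumFields.BalabanUV.T4Continuum.SpaceTimePeierls.exists_covering_walk (pieceGraph plegs)
      (s + 1) S hcard hconn hv
  obtain ⟨q, hq, hqs⟩ := exists_walk_length_add_two_mul p (by omega) (t - s)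
  have hl : q.length = 2 * t := by rw [hq]; omega
  exact ⟨(v, q.support), hl ▸ support_mem_walksU plegs (hS v hv) q, hqs.trans hsupp⟩

/-- Membership in the left side. -/
theorem mem_sidesOf_fst {vis : List Lab} {P : Lab} : P ∈ (sidesOf vis).1 ↔ P ∈ vis ∧ P.1 = 0 := by
  rw [show (sidesOf vis).1 = (vis.filter fun P => P.1 = 0).dedup from rfl, List.mem_dedup, List.mem_filter, decide_eq_true_eq]

/-- Membership in the right side. -/
theorem mem_sidesOf_snd {vis : List Lab} {P : Lab} : P ∈ (sidesOf vis).2 ↔ P ∈ vis ∧ P.1 = 1 := by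
  rw [show (sidesOf vis).2 = (vis.filter fun P => P.1 = 1).dedup from rfl, List.mem_dedup, List.mem_filter, decide_eq_true_eq]

/-- The sides have no duplicates. -/
theorem nodup_sidesOf (vis : List Lab) : (sidesOf vis).1.Nodup ∧ (sidesOf vis).2.Nodup :=
  ⟨List.nodup_dedup _, List.nodup_dedup _⟩

/-- Pieces carry side tag `0` or `1`. -/
theorem fst_le_one_of_mem_pieces {P : Lab} (h : P ∈ pieces plegs) : P.1 = 0 ∨ P.1 = 1 := by
  unfold pieces at h
  rw [List.mem_dedup, List.mem_append, List.mem_map, List.mem_map] at h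
  rcases h with ⟨x, _, rfl⟩ | ⟨x, _, rfl⟩
  · exact Or.inl rfl
  · exact Or.inr rfl

/-- The total size of the two sides of a duplicate-free vertex list of pieces is its size. -/
theorem length_sidesOf_add {vis : List Lab} (hvis : ∀ P ∈ vis, P ∈ pieces plegs) :
    (sidesOf vis).1.length + (sidesOf vis).2.length = vis.toFinset.card := by
  classical
  have hdisj : Disjoint ((vis.filter fun P => P.1 = 0).dedup.toFinset) ((vis.filter fun P => P.1 = 1).dedup.toFinset) := by
    rw [Finset.disjoint_left]
    intro P h1 h2
    simp only [List.mem_toFinset, List.mem_dedup, List.mem_filter, decide_eq_true_eq] at h1 h2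
    rw [h1.2] at h2
    exact absurd h2.2 (by decide)
  have hunion : (vis.filter fun P => P.1 = 0).dedup.toFinset ∪ (vis.filter fun P => P.1 = 1).dedup.toFinset
      = vis.toFinset := by
    ext P
    simp only [Finset.mem_union, List.mem_toFinset, List.mem_dedup, List.mem_filter, decide_eq_true_eq]
    constructor
    · rintro (⟨h, _⟩ | ⟨h, _⟩) <;> exact h
    · intro h
      rcases fst_le_one_of_mem_pieces plegs (hvis P h) with h0 | h1
      · exact Or.inl ⟨h, h0⟩
      · exact Or.inr ⟨h, h1⟩
  rw [show (sidesOf vis).1 = (vis.filter fun P => P.1 = 0).dedup from rfl,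
    show (sidesOf vis).2 = (vis.filter fun P => P.1 = 1).dedup from rfl, ← List.toFinset_card_of_nodup (List.nodup_dedup _),
    ← List.toFinset_card_of_nodup (List.nodup_dedup _), ← Finset.card_union_of_disjoint hdisj, hunion]

/-- **COMPLETENESS OF THE CANDIDATE LIST**: if the cap is not binding, every connected set `S` of pieces with
`2 ≤ #S ≤ t₀` appears (as its pair of sides) among the candidates computed with `2(t₀ − 1)` rounds. -/
theorem exists_mem_cands (cap t₀ : ℕ) (u : List Unit) (hu : u.length = 2 * (t₀ - 1))
    (hcap : ∀ k, k ≤ u.length → (walksU plegs k).length ≤ cap)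
    (S : Finset Lab) (hS : ∀ P ∈ S, P ∈ pieces plegs) (h2 : 2 ≤ S.card) (ht : S.card ≤ t₀)
    (hconn : ((pieceGraph plegs).induce (S : Set Lab)).Connected) :
    ∃ W ∈ cands plegs cap t₀ u, ∃ vis : List Lab, W = sidesOf vis ∧ vis.toFinset = S := by
  obtain ⟨w, hw, hwS⟩ := exists_mem_walksU_exact plegs S hS (s := S.card - 1) (t := t₀ - 1)
    (by omega) (by omega) (by omega) hconn
  refine ⟨sidesOf w.2, ?_, w.2, rfl, hwS⟩
  unfold cands
  rw [List.mem_filter, List.mem_map]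
  refine ⟨⟨w, ?_, rfl⟩, ?_⟩
  · rw [walksC_eq_walksU plegs cap u hcap, hu]; exact hw
  · rw [decide_eq_true_eq, length_sidesOf_add plegs (fun P hP => hS P (by rw [← hwS]; exact List.mem_toFinset.2 hP)),
      hwS]
    exact ht

end Candidates

/-! ## M2c (iii): the history of the spots -/

section Spots

variable (γsq : ℕ) (plegs : List PLeg) (cs : List Cand)

/-- Relabelling does not change the number of legs of an OLD spot (`c ≠ 0`, `c ≠ r + 1`). -/
theorem count_relabel_of_ne (W : Cand) (r c : ℕ) (hc0 : c ≠ 0) (hcr : c ≠ r + 1) :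
    ∀ (labels : List ℕ) (pl : List PLeg), labels.length = pl.length →
      (relabel pl labels r W).count c = labels.count c := by
  intro labels
  induction labels with
  | nil => intro pl h; simp [relabel]
  | cons a as ih =>
    intro pl h
    cases pl with
    | nil => simp at h
    | cons b bs =>
      have h' : as.length = bs.length := by simpa using h
      have ih' := ih bs h'
      unfold relabel at ih' ⊢
      rw [List.zipWith_cons_cons, List.count_cons, List.count_cons, ih']
      by_cases hp : inPair W (a, b) = true
      · have ha : a = 0 := by
          simp only [inPair, Bool.and_eq_true, decide_eq_true_eq] at hp
          exact hp.1
        rw [if_pos hp, ha]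
        have h1 : (r + 1 == c) = false := by simpa using fun h => hcr h.symm
        have h2 : ((0 : ℕ) == c) = false := by simpa using fun h => hc0 h.symm
        rw [h1, h2]
      · rw [if_neg hp]

/-- Relabelling gives the NEW spot exactly `e` legs (when no old label is `r + 1`). -/
theorem count_relabel_new (W : Cand) (r : ℕ) :
    ∀ (labels : List ℕ) (pl : List PLeg), labels.length = pl.length → (∀ a ∈ labels, a ≤ r) →
      (relabel pl labels r W).count (r + 1) = ((labels.zip pl).filter fun q => inPair W q).length := by
  intro labels
  induction labels with
  | nil => intro pl h _; simp [relabel]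
  | cons a as ih =>
    intro pl h hle
    cases pl with
    | nil => simp at h
    | cons b bs =>
      have h' : as.length = bs.length := by simpa using h
      have ih' := ih bs h' (fun x hx => hle x (List.mem_cons_of_mem _ hx))
      have har : a ≤ r := hle a (by simp)
      unfold relabel at ih' ⊢
      rw [List.zipWith_cons_cons, List.zip_cons_cons, List.filter_cons, List.count_cons, ih']
      by_cases hp : inPair W (a, b) = true
      · rw [if_pos hp, if_pos hp, List.length_cons]
        simp
      · rw [if_neg hp, if_neg hp]
        have : (a == r + 1) = false := by simpa using (by omega : a ≠ r + 1)
        rw [this]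
        simp

/-- THE SPOT INVARIANT: every spot `s < r` was extracted from a candidate pair `W`: all its legs run inside
`W`, and it was dense at extraction, `γsq·|W₁|·|W₂| < (#legs of spot s)²`. -/
def SpotInv (st : List ℕ × ℕ) : Prop :=
  ∀ s, s < st.2 → ∃ W ∈ cs,
    (∀ (i : ℕ) (hi : i < st.1.length) (hp : i < plegs.length), st.1[i] = s + 1 →
        labL plegs[i] ∈ W.1 ∧ labR plegs[i] ∈ W.2) ∧
    γsq * W.1.length * W.2.length < st.1.count (s + 1) * st.1.count (s + 1)

/-- Initially there are no spots. -/
theorem spotInv_init : SpotInv γsq plegs cs (extractInit plegs) := fun s hs => absurd hs (Nat.not_lt_zero s)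

/-- One round preserves the spot invariant (given the label invariant). -/
theorem spotInv_step {k : ℕ} {st : List ℕ × ℕ} (hI : ExtractInv plegs k st) (hS : SpotInv γsq plegs cs st) :
    SpotInv γsq plegs cs (extractStep γsq plegs cs st) := by
  obtain ⟨hlen, hlab, _⟩ := hI
  unfold extractStep
  cases hf : cs.find? (fun W => dense γsq plegs st.1 W) with
  | none => exact hS
  | some W =>
    have hW : W ∈ cs := List.mem_of_find?_eq_some hf
    have hd : dense γsq plegs st.1 W = true := List.find?_some hf
    intro s hs
    simp only at hs ⊢
    by_cases hsr : s < st.2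
    · -- an old spot: untouched
      obtain ⟨W', hW', hgeo, hdense⟩ := hS s hsr
      refine ⟨W', hW', fun i hi hp hlab' => ?_, ?_⟩
      · rw [getElem_relabel plegs st.1 st.2 W i hi (by rw [hlen]; exact hp) hp] at hlab'
        split_ifs at hlab' with hq
        · omega
        · exact hgeo i (by rw [hlen]; exact hp) hp hlab'
      · rw [count_relabel_of_ne W st.2 (s + 1) (Nat.succ_ne_zero s) (by omega) st.1 plegs hlen]
        exact hdense
    · -- the new spot `s = r`
      have hs' : s = st.2 := by omega
      subst hs'
      refine ⟨W, hW, fun i hi hp hlab' => ?_, ?_⟩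
      · rw [getElem_relabel plegs st.1 st.2 W i hi (by rw [hlen]; exact hp) hp] at hlab'
        split_ifs at hlab' with hq
        · simp only [inPair, Bool.and_eq_true, decide_eq_true_eq] at hq
          exact hq.2
        · have := hlab _ (List.getElem_mem (by rw [hlen]; exact hp))
          omega
      · rw [count_relabel_new W st.2 st.1 plegs hlen hlab]
        unfold dense eCount at hd
        rwa [decide_eq_true_eq] at hd

/-- The spot invariant along the fold. -/
theorem spotInv_foldl :
    ∀ (u : List Unit) (k : ℕ) (st : List ℕ × ℕ), ExtractInv plegs k st → SpotInv γsq plegs cs st →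
      SpotInv γsq plegs cs (u.foldl (fun st _ => extractStep γsq plegs cs st) st) := by
  intro u
  induction u with
  | nil => intro k st _ h; exact h
  | cons _ u ih =>
    intro k st hI hS
    rw [List.foldl_cons]
    exact ih (k + 1) _ (extractInv_step γsq plegs cs hI) (spotInv_step γsq plegs cs hI hS)

/-- **THE SPOTS OF THE EXTRACTION**: each was taken from a candidate pair inside which all its legs run,
and it was dense there. -/
theorem spotInv_extract (u : List Unit) : SpotInv γsq plegs cs (extract γsq plegs cs u) :=
  spotInv_foldl γsq plegs cs u 0 (extractInit plegs) (extractInv_init plegs) (spotInv_init γsq plegs cs)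

end Spots

end Summit.PneNP.PneNP.Theorems.SfmBlMachine
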